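import Summits.Ventures.CertifiedManyBodySolver.Rows.HubbardChainMPSRaw6TrNodesNszb
import Summits.Ventures.CertifiedManyBodySolver.Rows.HubbardChainMPSRaw5TrNodesSrot
import Summits.Ventures.CertifiedManyBodySolver.Transport.MPSPrimalRaw5SrotNszb
import HarnessLib

/-!
# Ventures/CertifiedManyBodySolver — Rows/HubbardChainMPSRaw5TrNodesNszb.lean: the `jw-srot` RAWLOW node with raw block `ρ₅` and STAGGERED
# CHARGE COMPONENTS (FORMAT-ksdn v0.5 `mps-rawlow` + v0.6 'staggered charge components', χ12 `nszb5`: `m₀ = 6`, injection `W₄`, `lmax_psd`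
# trace bounds, bond labels a pair) and its solver-free edges

HONEST FRAMING: first certified bounds; not a superconductivity verdict; every number certified or labelled float.

Speedrun cell sr-mbsolver / programme hubbard-alg, LIT team (lit-1 gen-26) — the CLAIM-NODE SHAPE for the BY-VALUE Lean cells of the χ12 two-label
`nszb5` certificates CERTIFIED #494 (U = 2) / #495 (U = 1) (the (2,1) / (1,1) chain cells of record; D3 CELL MOVES 105 / 106; window-level instance
lit-4 p414825 `Certificates/HubbardChain_n1_ksdn_chi12nszb5_n48_rows494_495.lean`), whose relaxation is `mps-rawlow` with `m₀ = 6`, `k = 5`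
(ranks `W₂/W₃/W₄` = 16/64/144), i.e. the raw head block `ρ₅` of `Rows/HubbardChainMPSRaw5TrNodesSrot.lean` (lit-1 g15, χ8) with the PAIR charges and the
staggered row of `Rows/HubbardChainMPSRaw6TrNodesNszb.lean` (lit-1 g18, χ12 `nszbc`, `m₀ = 7`). It is that file VERBATIM with: raw head block
`ρ₅ : Op (PolySite {-1,…,3}) 4` (coordinates `chainWindowFiveEquiv : Fin 5 ≃ {-1,…,3}`, `i ↦ i − 1`), rows E6L / E6R through `W₄ = cgMap (castTensor A) 4`,
compressed levels `ω₆ … ω_N`, `N = n + 3 ≥ 6`; everything else (the window node WITH the staggered row `LTIChainKSDNNodeSrotNszb`, the pair charge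
`hubbardNszbQeff`, `mpsCovNszb_of_rat`, `LTIChainKSDNNodeSrot.nszb`, the window-level edges) is IMPORTED from it by name. New here: the node
`MPSChainKSDNRaw5TrNodeNszb` and its edges `.mono`, `.ltiChainKSDNNodeSrotNszb` (via `Transport.ksdnSrotNszbClaim_of_mpsRaw5SrotNszbTrClaim`),
`.ltiChainKSDNNode`, `.m1EnergyLowerRow`, `.m1DopedEnergyLowerRow`. No `sorry`, no new axiom, no named fact; the node is a `def … : Prop` taken as
hypothesis by the Certificates/ instances.
[cite: KullEtAl2024, §2.5 eq. (TNfullRelax5), §3.3, §4.2 eq. (relaxLocTIn), §6.2] [cite: ArakiMoriya2003, §4.1] [cite: EsslerEtAl2005, §12.3.4]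
-/

noncomputable section

open Matrix Complex Filter Topology
open scoped ComplexOrder Kronecker BigOperators MatrixOrder
open Literature.Probability.LatticeModels
open Literature.MathematicalPhysics.QuantumLattice
open Literature.MathematicalPhysics.QuantumLattice.HubbardWave0
open Literature.MathematicalPhysics.QuantumLattice.ThermodynamicLimit
open Literature.MathematicalPhysics.QuantumLattice.JordanWigner
open Literature.MathematicalPhysics.QuantumManyBody.StateRelaxation
open Literature.MathematicalPhysics.QuantumLattice.MPSCoarseGraining
open Literature.Computability.QuantumComplexity (traceLeft traceRight)
open Summit.Ventures.CertifiedManyBodySolver.Transport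

namespace Summit.Ventures.CertifiedManyBodySolver

/-! ## §B  The node predicate (window `{-1, …, n+1}` of `N = n + 3 ≥ 6` sites, raw block `ρ₅`, bond dimension `D`, model `hubbard_jwsrot(U)`, `t = 1`) -/

section Nodes

/-- **`jw-srot` `relax = mps-rawlow(N, D, A)` node with raw block `ρ₅` (`m₀ = 6`), TRACE BOUNDS and STAGGERED CHARGE COMPONENTS, `ksdn-inst/1` v0.5 + v0.6
`nszb` form** (the χ12 `nszb5` instances of CERTIFIED #494 / #495; the `hclaim` of `Transport.ksdnSrotNszbClaim_of_mpsRaw5SrotNszbTrClaim` at `t = 1` with rational data and `qs = hubbardNszbQeff cb ca cm`):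
for all variables `ρ₅ : Op (PolySite {-1,…,3}) 4` and `ω m` (`6 ≤ m ≤ n + 3`, indexed `(s_L, (a,b), s_R)`), IF `ρ₅ ⪰ 0`, `tr ρ₅ = 1`, the LTI row
`tr_{-1} ρ₅ = tr_{3} ρ₅`, the TOTAL-OCCUPATION sector zeros, the STAGGERED-SPIN sector zeros, the total density of site `-1` equal to `ν`, real
entries, `|ρ₅| ≤ 1`; rows E6L / E6R (through `chainWindowFiveEquiv`, `W₄ = cgMap (castTensor A) 4`), E_mL / E_mR for `7 ≤ m ≤ n+3`; `ω_m ⪰ 0`, sector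
zeros for the site-indexed pair tags `cgTagAt (hubbardNszbQeff cb ca cm) qb 0 (m−2)`, real entries, `|ω_m| ≤ B m` AND `Re tr ω_m ≤ B m` (`6 ≤ m ≤ n+3`) —
THEN `lo ≤ Re tr(toSpin(U n_{-1↑}n_{-1↓} − Σ_σ (c†_{-1σ} c_{0σ̄} + c†_{0σ̄} c_{-1σ})) ρ₅)`. By-name audit token: predicate NAME +
`(U, n + 3 = the file's n, D, ν, lo)` + the tables `A`, `qb` (pairs per bond index AND position parity: `qb x a = (q_N(a), (−1)^x (2u_a − κ))`),
`(cb, ca, cm)`, `B m` (= `bounds.levels[m].r`, m ≥ 6). [cite: KullEtAl2024, §2.5 eq. (TNfullRelax5), §3.3, §4.2 eq. (relaxLocTIn), §6.2] -/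
def MPSChainKSDNRaw5TrNodeNszb (U : ℝ) (n D : ℕ) (A : Fin 4 → Matrix (Fin D) (Fin D) ℚ) (qb : ℕ → Fin D → ℤ × ℤ) (cb ca cm : ℤ)
    (B : ℕ → ℚ) (ν lo : ℚ) : Prop :=
  ∀ (ρ₅ : Op (PolySite (chainWindow (-1) 3)) 4)
    (ω : ℕ → Matrix (Fin 4 × ((Fin D × Fin D) × Fin 4)) (Fin 4 × ((Fin D × Fin D) × Fin 4)) ℂ),
    ρ₅.PosSemidef → ρ₅.trace = 1 →
    spinPartialTrace ((PolySite.affEmb 1 (unitVec 0) (chainWindow (-1) 2)).trans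
        (PolySite.incl affShiftSet_chainWindow_two_subset_three)) ρ₅ =
      spinPartialTrace (PolySite.incl chainWindow_two_subset_three) ρ₅ →
    (∀ k k' : TensorIndex (PolySite (chainWindow (-1) 3)) 4,
      (∑ x, (siteOcc (k x)).card) ≠ (∑ x, (siteOcc (k' x)).card) → ρ₅ k k' = 0) →
    (∀ k k' : TensorIndex (PolySite (chainWindow (-1) 3)) 4,
      (∑ y : PolySite (chainWindow (-1) 3), (if Odd (ofLex y.1 0) then (-1 : ℤ) else 1) *
          ((if (0 : Fin 2) ∈ siteOcc (k y) then 1 else 0 : ℤ) - (if (1 : Fin 2) ∈ siteOcc (k y) then 1 else 0 : ℤ))) ≠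
        (∑ y : PolySite (chainWindow (-1) 3), (if Odd (ofLex y.1 0) then (-1 : ℤ) else 1) *
          ((if (0 : Fin 2) ∈ siteOcc (k' y) then 1 else 0 : ℤ) - (if (1 : Fin 2) ∈ siteOcc (k' y) then 1 else 0 : ℤ))) →
      ρ₅ k k' = 0) →
    ((toSpin (nAt (-unitVec 0) neg_unitVec_mem_chainWindow_three 0 + nAt (-unitVec 0) neg_unitVec_mem_chainWindow_three 1) *
        ρ₅).trace).re = ((ν : ℚ) : ℝ) →
    (∀ k k' : TensorIndex (PolySite (chainWindow (-1) 3)) 4, starRingEnd ℂ (ρ₅ k k') = ρ₅ k k') →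
    (∀ k k' : TensorIndex (PolySite (chainWindow (-1) 3)) 4, ‖ρ₅ k k'‖ ≤ 1) →
    traceLeft (ω 6) = (cgMap (castTensor A) 4 ⊗ₖ (1 : Matrix (Fin 4) (Fin 4) ℂ)) *
        (ρ₅.submatrix (Equiv.arrowCongr chainWindowFiveEquiv (Equiv.refl (Fin 4)))
            (Equiv.arrowCongr chainWindowFiveEquiv (Equiv.refl (Fin 4)))).submatrix
          ((Equiv.prodComm _ _).trans (Fin.snocEquiv fun _ => Fin 4))
          ((Equiv.prodComm _ _).trans (Fin.snocEquiv fun _ => Fin 4)) *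
      (cgMap (castTensor A) 4 ⊗ₖ (1 : Matrix (Fin 4) (Fin 4) ℂ))ᴴ →
    traceRight ((ω 6).submatrix (Equiv.prodAssoc _ _ _) (Equiv.prodAssoc _ _ _)) =
      ((1 : Matrix (Fin 4) (Fin 4) ℂ) ⊗ₖ cgMap (castTensor A) 4) *
        (ρ₅.submatrix (Equiv.arrowCongr chainWindowFiveEquiv (Equiv.refl (Fin 4)))
            (Equiv.arrowCongr chainWindowFiveEquiv (Equiv.refl (Fin 4)))).submatrix
          (Fin.consEquiv fun _ => Fin 4) (Fin.consEquiv fun _ => Fin 4) *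
      ((1 : Matrix (Fin 4) (Fin 4) ℂ) ⊗ₖ cgMap (castTensor A) 4)ᴴ →
    (∀ k, k + 7 ≤ n + 3 → traceLeft (ω (k + 7)) =
      (leftMap (castTensor A) ⊗ₖ (1 : Matrix (Fin 4) (Fin 4) ℂ)) *
        (ω (k + 6)).submatrix (Equiv.prodAssoc _ _ _) (Equiv.prodAssoc _ _ _) *
      (leftMap (castTensor A) ⊗ₖ (1 : Matrix (Fin 4) (Fin 4) ℂ))ᴴ) →
    (∀ k, k + 7 ≤ n + 3 → traceRight ((ω (k + 7)).submatrix (Equiv.prodAssoc _ _ _) (Equiv.prodAssoc _ _ _)) =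
      ((1 : Matrix (Fin 4) (Fin 4) ℂ) ⊗ₖ rightMap (castTensor A)) * ω (k + 6) *
      ((1 : Matrix (Fin 4) (Fin 4) ℂ) ⊗ₖ rightMap (castTensor A))ᴴ) →
    (∀ k, k + 6 ≤ n + 3 → (ω (k + 6)).PosSemidef) →
    (∀ k, k + 6 ≤ n + 3 → ∀ i j,
      cgTagAt (hubbardNszbQeff cb ca cm) qb 0 (k + 4) i ≠ cgTagAt (hubbardNszbQeff cb ca cm) qb 0 (k + 4) j → ω (k + 6) i j = 0) →
    (∀ k, k + 6 ≤ n + 3 → ∀ i j, starRingEnd ℂ (ω (k + 6) i j) = ω (k + 6) i j) →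
    (∀ k, k + 6 ≤ n + 3 → ∀ i j, ‖ω (k + 6) i j‖ ≤ ((B (k + 6) : ℚ) : ℝ)) →
    (∀ k, k + 6 ≤ n + 3 → ((ω (k + 6)).trace).re ≤ ((B (k + 6) : ℚ) : ℝ)) →
    ((lo : ℚ) : ℝ) ≤ ((toSpin ((U : ℂ) • (nAt (-unitVec 0) neg_unitVec_mem_chainWindow_three 0 *
          nAt (-unitVec 0) neg_unitVec_mem_chainWindow_three 1) +
        (-((1 : ℝ) : ℂ)) • ∑ σ : Fin 2,
          ((cAt (-unitVec 0) neg_unitVec_mem_chainWindow_three σ)ᴴ * cAt 0 zero_mem_chainWindow_three σ.rev +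
            (cAt 0 zero_mem_chainWindow_three σ.rev)ᴴ * cAt (-unitVec 0) neg_unitVec_mem_chainWindow_three σ)) * ρ₅).trace).re


end Nodes

/-! ## §C  Solver-free edges -/

section Edges

variable {U : ℝ} {n D : ℕ} {A : Fin 4 → Matrix (Fin D) (Fin D) ℚ} {qb : ℕ → Fin D → ℤ × ℤ} {cb ca cm : ℤ} {B : ℕ → ℚ} {ν lo lo' : ℚ}

/-- A node survives a SMALLER slot `lo' ≤ lo`. -/
theorem MPSChainKSDNRaw5TrNodeNszb.mono (h : MPSChainKSDNRaw5TrNodeNszb U n D A qb cb ca cm B ν lo) (hlo : lo' ≤ lo) :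
    MPSChainKSDNRaw5TrNodeNszb U n D A qb cb ca cm B ν lo' :=
  fun ρ₅ ω h1 h2 h3 h4 h5 h6 h7 h8 h9 h10 h11 h12 h13 h14 h15 h16 h17 =>
    le_trans (by exact_mod_cast hlo) (h ρ₅ ω h1 h2 h3 h4 h5 h6 h7 h8 h9 h10 h11 h12 h13 h14 h15 h16 h17)

/-- **THE RAWLOW-`nszb` EDGE BY NAME: a `jw-srot` `mps-rawlow` (`ρ₅`, staggered charge components) certificate is a `jw-srot` window certificate
with staggered sectors** (`N = n + 3 ≥ 6`): under the side conditions (site-indexed pair-charge covariance of `A`; the `lmax_psd` rule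
`W_{m−2}ᴴW_{m−2} ≤ (B m)·𝟙`, `0 ≤ B m`, m = 6…N, over `ℂ` for `castTensor A`),
`MPSChainKSDNRaw5TrNodeNszb U n D A qb cb ca cm B ν lo → LTIChainKSDNNodeSrotNszb U n ν lo`. Solver-free: KSDN's feasible point with site-indexed
sectors (`Transport.ksdnSrotNszbClaim_of_mpsRaw5SrotNszbTrClaim`). [cite: KullEtAl2024, §3.3, §4.2] -/
theorem MPSChainKSDNRaw5TrNodeNszb.ltiChainKSDNNodeSrotNszb (h : MPSChainKSDNRaw5TrNodeNszb U n D A qb cb ca cm B ν lo) (hn : 3 ≤ n)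
    (hAcov : ∀ x s a b, A s a b ≠ 0 → qb (x + 1) b = qb x a + hubbardNszbQeff cb ca cm x s)
    (hB : ∀ k, k + 6 ≤ n + 3 → 0 ≤ ((B (k + 6) : ℚ) : ℝ) ∧
      (cgMap (castTensor A) (k + 4))ᴴ * cgMap (castTensor A) (k + 4) ≤
        ((B (k + 6) : ℚ) : ℝ) • (1 : Matrix (Fin (k + 4) → Fin 4) (Fin (k + 4) → Fin 4) ℂ)) :
    LTIChainKSDNNodeSrotNszb U n ν lo :=
  ksdnSrotNszbClaim_of_mpsRaw5SrotNszbTrClaim 1 U n hn (castTensor A) (star_castTensor_apply A) (hubbardNszbQeff cb ca cm) qb cb ca cm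
    (fun _ _ => rfl) (mpsCovNszb_of_rat hAcov) (fun m => ((B m : ℚ) : ℝ)) hB chainWindowFiveEquiv chainWindowFiveEquiv_coord h

/-- **`jw-srot` `mps-rawlow` `nszb` certificate ⇒ standard `lti(N)` certificate** (composite edge through `LTIChainKSDNNodeSrotNszb`).
[cite: KullEtAl2024, §4.2, §VI.B] -/
theorem MPSChainKSDNRaw5TrNodeNszb.ltiChainKSDNNode (h : MPSChainKSDNRaw5TrNodeNszb U n D A qb cb ca cm B ν lo) (hn : 3 ≤ n)
    (hAcov : ∀ x s a b, A s a b ≠ 0 → qb (x + 1) b = qb x a + hubbardNszbQeff cb ca cm x s)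
    (hB : ∀ k, k + 6 ≤ n + 3 → 0 ≤ ((B (k + 6) : ℚ) : ℝ) ∧
      (cgMap (castTensor A) (k + 4))ᴴ * cgMap (castTensor A) (k + 4) ≤
        ((B (k + 6) : ℚ) : ℝ) • (1 : Matrix (Fin (k + 4) → Fin 4) (Fin (k + 4) → Fin 4) ℂ)) :
    LTIChainKSDNNode U n ν lo :=
  (h.ltiChainKSDNNodeSrotNszb hn hAcov hB).ltiChainKSDNNode

end Edges

/-! ## §D  The M1 cells BY NAME -/

section Cells

variable {U : ℝ} {n D : ℕ} {A : Fin 4 → Matrix (Fin D) (Fin D) ℚ} {qb : ℕ → Fin D → ℤ × ℤ} {cb ca cm : ℤ} {B : ℕ → ℚ} {ν lo : ℚ}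
  {p q : ℕ}

/-- **M1 cell BY NAME** (`ν = 1`, `U ≥ 0`): a `jw-srot` rawlow `nszb` node at half filling ⇒ `lo ≤ e₀(U)` (`M1EnergyLowerRow U lo`). -/
theorem MPSChainKSDNRaw5TrNodeNszb.m1EnergyLowerRow (h : MPSChainKSDNRaw5TrNodeNszb U n D A qb cb ca cm B 1 lo) (hn : 3 ≤ n) (hU : 0 ≤ U)
    (hAcov : ∀ x s a b, A s a b ≠ 0 → qb (x + 1) b = qb x a + hubbardNszbQeff cb ca cm x s)
    (hB : ∀ k, k + 6 ≤ n + 3 → 0 ≤ ((B (k + 6) : ℚ) : ℝ) ∧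
      (cgMap (castTensor A) (k + 4))ᴴ * cgMap (castTensor A) (k + 4) ≤
        ((B (k + 6) : ℚ) : ℝ) • (1 : Matrix (Fin (k + 4) → Fin 4) (Fin (k + 4) → Fin 4) ℂ)) :
    M1EnergyLowerRow U lo :=
  (h.ltiChainKSDNNodeSrotNszb hn hAcov hB).m1EnergyLowerRow hU

/-- **M1 doped cell BY NAME** (`ν = p/q`, `1 ≤ q`, `p ≤ 2q`, `U ≥ 0`): `lo ≤ e₀(U, n = p/q)` (`M1DopedEnergyLowerRow U p q lo`). -/
theorem MPSChainKSDNRaw5TrNodeNszb.m1DopedEnergyLowerRow (h : MPSChainKSDNRaw5TrNodeNszb U n D A qb cb ca cm B ν lo) (hn : 3 ≤ n)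
    (hU : 0 ≤ U) (hq : 1 ≤ q) (hp : p ≤ 2 * q) (hν : ((ν : ℚ) : ℝ) = (p : ℝ) / (q : ℝ))
    (hAcov : ∀ x s a b, A s a b ≠ 0 → qb (x + 1) b = qb x a + hubbardNszbQeff cb ca cm x s)
    (hB : ∀ k, k + 6 ≤ n + 3 → 0 ≤ ((B (k + 6) : ℚ) : ℝ) ∧
      (cgMap (castTensor A) (k + 4))ᴴ * cgMap (castTensor A) (k + 4) ≤
        ((B (k + 6) : ℚ) : ℝ) • (1 : Matrix (Fin (k + 4) → Fin 4) (Fin (k + 4) → Fin 4) ℂ)) :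
    M1DopedEnergyLowerRow U p q lo :=
  (h.ltiChainKSDNNodeSrotNszb hn hAcov hB).m1DopedEnergyLowerRow hU hq hp hν

end Cells

end Summit.Ventures.CertifiedManyBodySolver

end
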